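import Literature.Barriers.CriticalPhenomena.LongRangeTrivialityOnZ3Moments
import Literature.Barriers.CriticalPhenomena.LongRangeTrivialityOnZ3TwoPoint
import Literature.Barriers.CriticalPhenomena.LongRangeTrivialityOnZ3LatticeSums

/-!
# Panis's bound on `S(β,L,f) = Σ_L⁻²∑|U₄|` on `ℤ³`, proved from the two-point-level facts; the barrier
# `LongRangeTrivialityOnZ3` from printed classical facts only

Sibling of `Literature/Barriers/CriticalPhenomena/LongRangeTrivialityOnZ3.lean` (barrier catalogue
D-0021, sub-problem `Ising3DConformalLimit`). `…Inputs` left the barrier resting on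
`panis_mgfDeviation_le_ursellFourBoxSum` (reduced to moment level in `…Moments`) and on
`panis_ursellFourBoxSum_le`, the bound `S(β,L,f) ≤ C(β⁻⁴∨β⁻²)r_f^γL^{-(d-2(α∧2))}` asserted on page 22
of Panis 2023 (arXiv:2309.05797, proof of Theorem 5.5). This file PROVES the `d = 3` instance of that
bound (all the barrier needs) from the five classical two-point-function facts vendored in `…TwoPoint`:

`panis_ursellFourBoxSum_le_dim3 : panis_treeDiagramBound → panis_mms_two_point_monotone →
  panis_slidingScale_infraredBound → panis_infraredBound_algebraic →
  panis_boxSusceptibility_le_blockVariance → (d = 3 instance of panis_ursellFourBoxSum_le)` (`γ = 11`),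

and assembles **`LongRangeTrivialityOnZ3.of_twoPoint`**: the barrier from
`panis_evenMoment_deviation_le`, `newman_gaussian_evenMoment_le` and those five facts (through
`panis_thm12_dim3`, the `d = 3` instance of Theorem 1.2, `panis_thm12_dim3_of_twoPoint`,
`not_hasNonGaussianSmearingZ3_of_thm12_dim3`, `LongRangeTrivialityOnZ3.of_thm12_dim3`).

## The printed argument (p. 22) and what had to be adjusted for a proof

With `F(u) := ∑_{y∈Λ_{RL}}⟨σ_uσ_y⟩` the tree diagram bound gives `∑_{Λ_{RL}⁴}|U₄| ≤ 2∑_u F(u)⁴`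
(`sum_abs_ursellFour_le`: in `ℝ≥0∞`, Fubini for the finite sum, `∑_{x∈Λ⁴}∏ᵢ⟨σ_{xᵢ}σ_u⟩ = F(u)⁴`, then back
to `ℝ` through a summable majorant). The source splits `u ∈ Λ_{dr_fL}` / `u ∉ Λ_{dr_fL}`; here the split
is at `Λ_{4RL}` (so that the Messager–Miracle-Solé comparison scale `m = ⌊|u-y|_∞/3⌋` stays `≥ L` also for
`R = 1`), and the distance in the far region is the honest `|u-y| ≥ (3/4)|u|` (the printed display (5.2)
writes `|x|` for `|x-x_i|`):

* near (`boxRowSum_le_near`): `F(u) ≤ χ_{5RL} ≤ 25 C R² χ_L/β` by translation invariance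
  (`sum_box_pairCorrelation_le`) and the sliding-scale bound between the scales `L` and `5RL`;
* far (`pairCorrelation_far_le_sliding`, `pairCorrelation_far_le_irb`, `boxRowSum_pow_four_le_far`): two
  factors `⟨σ_uσ_y⟩ ≤ Cχ_L/(βL²|u|)` (MMS2 on `Λ_m`, `χ_m ≥ (2m+1)³⟨σ₀σ_{u-y}⟩`, then Theorem 3.18 between
  `L` and `m`), two factors `⟨σ_uσ_y⟩ ≤ 3C_E|u|^{-(1+η)}` (infrared bound, `η = 2-α`), whence
  `F(u)⁴ ≤ B|u|^{-(4+2η)}`, `B = 9C²C_E²(2RL+1)¹²χ_L²/(β²L⁴)`; the tail `∑_{|u|>4RL}|u|^{-(4+2η)} ≤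
  26(4RL)^{-(1+2η)}/(1+2η)` converges for every `η ≥ 0` in `d = 3` (`rowMajorant`, `sum_rowMajorant_le`,
  `summable_rowMajorant`);
* bookkeeping (`near_term_le`, `far_term_le`, `boxSusceptibility_le_of_irb`): `χ_L/Σ_L ≤ C₂L^{-3}`,
  `χ_L ≤ C₄L^{2-η}` (`C₄ = 1 + 26C_E(1+1/(2-η))`), `(8RL+1)³ ≤ 729R³L³`, `(2RL+1)¹² ≤ 3¹²R¹²L¹²`, giving
  `S ≤ (K₁β⁻⁴ + K₂β⁻²)R¹¹L^{1-2η}` and `1 - 2η = -(3-2α)`.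

Scope: `d = 3` only (the vendored Theorem 3.18 is `d ≥ 2` and the infrared bound `d ≥ 3`; the printed
`d = 1` case of Theorem 5.5 is not covered by the printed route); the general-`d` named fact
`panis_ursellFourBoxSum_le` stays as vendored. After this file the barrier's trust base is the seven
printed facts listed in `LongRangeTrivialityOnZ3.of_twoPoint`, of which `panis_evenMoment_deviation_le`
and `newman_gaussian_evenMoment_le` are random-current/Lee–Yang statements and the five others
reflection-positivity/random-current statements about the two-point function; relation to the tree:
Aizenman's tree diagram bound and the MMS inequalities are vendored/proved for two other model
formalisations (`Literature.Barriers.CriticalPhenomena.treeDiagramBound` for unit couplings on finite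
graphs, `Literature.Probability.LatticeModels.aizenman_treeDiagramBound` and `messager_miracleSole` for
the nearest-neighbour DLR state), not for weighted long-range couplings.

## References

* R. Panis, arXiv:2309.05797 (2023) = Ann. Probab. 54 (2026): proof of Theorem 5.5 (pp. 21–22),
  Theorem 1.2, Remark 5.4, §4.2, Corollary 3.3, Theorem 3.18, §3.6 [Panis2023Triviality] (held; read).
-/

noncomputable section

namespace Literature.Barriers.CriticalPhenomena

open Literature.Probability.LatticeModels Literature.Probability.Percolation Filter Topology Finset
open scoped ENNReal

namespace LongRangeIsing

/-! ### Pointwise bounds on the two-point function of `ℤ³` far from a box (p. 22, bound on (2)) -/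

section FarBounds

variable (J : Site 3 → Site 3 → ℝ) (β : ℝ)

/-- `8m³ ≤ (2m+1)³`, in the form `m²/(2m+1)³ ≤ 1/(8m)` for `m ≥ 1`. [folklore] -/
theorem sq_div_cube_le {m : ℕ} (hm : 1 ≤ m) : (m : ℝ) ^ 2 / ((2 * m + 1 : ℕ) : ℝ) ^ 3 ≤ 1 / (8 * m) := by
  have hm0 : (0 : ℝ) < m := by exact_mod_cast hm
  rw [div_le_div_iff₀ (by positivity) (by positivity)]
  push_cast
  nlinarith [hm0, sq_nonneg (m : ℝ), mul_pos hm0 hm0]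

/-- **MMS + sliding scale, far from the box** (the inequality (5.2) of the source, here with the
correct distance `|u-y|`): if `S(0,·)` is `3`-monotone decreasing (MMS2), `χ_m/m² ≤ (C/β)χ_L/L²` for
`L ≤ m`, then for `|u|_∞ ≥ 4RL+1` and `y ∈ Λ_{RL}`,
`⟨σ_uσ_y⟩ ≤ C χ_L(β) / (β L² |u|_∞)`. [cite: Panis2023Triviality, proof of Theorem 5.5, bound on (2), display (5.2), p. 22] -/
theorem pairCorrelation_far_le_sliding (hβ : 0 < β) (hJ : ∀ x y, 0 ≤ J x y)
    (hJt : ∀ a x y, J (x + a) (y + a) = J x y)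
    (hmms : ∀ x y : Site 3, (3 : ℝ) * ‖x‖ ≤ ‖y‖ → pairCorrelation J β 0 y ≤ pairCorrelation J β 0 x)
    {C : ℝ} (hss : ∀ ℓ m : ℕ, 1 ≤ ℓ → ℓ ≤ m →
      boxSusceptibility J β m / (m : ℝ) ^ 2 ≤ C / β * (boxSusceptibility J β ℓ / (ℓ : ℝ) ^ 2))
    {R L : ℕ} (hR : 1 ≤ R) (hL : 1 ≤ L) {u y : Site 3} (hu : 4 * (R * L) + 1 ≤ Site.supNorm u) (hy : y ∈ box 3 (R * L)) :
    pairCorrelation J β u y ≤ C * boxSusceptibility J β L / (β * (L : ℝ) ^ 2 * Site.supNorm u) := by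
  set w : Site 3 := y - u with hw
  set n : ℕ := Site.supNorm w with hn
  set m : ℕ := n / 3 with hm
  have hRL : 1 ≤ R * L := Nat.one_le_iff_ne_zero.2 (Nat.mul_ne_zero (by omega) (by omega))
  have hyRL : Site.supNorm y ≤ R * L := mem_box_iff_supNorm_le.1 hy
  -- `n ≥ 3RL + 1`, `n ≥ 4`, `m ≥ RL ≥ L`, `6m ≥ n`, `4n ≥ 3|u|`
  have htri : Site.supNorm u ≤ n + Site.supNorm y := by
    have h := Site.supNorm_le_supNorm_sub_add u y
    rwa [← Site.supNorm_neg (u - y), neg_sub, ← hw] at h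
  have hn1 : 3 * (R * L) + 1 ≤ n := by omega
  have hmL : L ≤ m := by
    rw [hm, Nat.le_div_iff_mul_le (by norm_num)]
    nlinarith
  have hm1 : 1 ≤ m := hL.trans hmL
  have h6m : n ≤ 6 * m := by omega
  have h4n : 3 * Site.supNorm u ≤ 4 * n := by omega
  have hm0 : (0 : ℝ) < m := by exact_mod_cast hm1
  have hn0 : (0 : ℝ) < n := by exact_mod_cast (show 0 < n by omega)
  have hu0 : (0 : ℝ) < Site.supNorm u := by exact_mod_cast (show 0 < Site.supNorm u by omega)
  have hL0 : (0 : ℝ) < L := by exact_mod_cast hL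
  -- MMS: `S(w) ≤ χ_m / (2m+1)³`
  have hSw : ∀ z ∈ box 3 m, pairCorrelation J β 0 w ≤ pairCorrelation J β 0 z := by
    intro z hz
    apply hmms
    rw [Site.norm_eq_supNorm, Site.norm_eq_supNorm]
    have hz' : Site.supNorm z ≤ m := mem_box_iff_supNorm_le.1 hz
    have : 3 * Site.supNorm z ≤ n := by omega
    exact_mod_cast this
  have hchi : (#(box 3 m) : ℝ) * pairCorrelation J β 0 w ≤ boxSusceptibility J β m := by
    rw [boxSusceptibility, ← nsmul_eq_mul, ← Finset.sum_const]
    exact Finset.sum_le_sum hSw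
  rw [card_box] at hchi
  -- sliding scale: `χ_m ≤ C m² χ_L / (β L²)`
  have hsl := hss L m hL hmL
  have hchiL0 : 0 ≤ boxSusceptibility J β L := boxSusceptibility_nonneg J β hβ.le hJ L
  have hchim : boxSusceptibility J β m ≤ C / β * (boxSusceptibility J β L / (L : ℝ) ^ 2) * (m : ℝ) ^ 2 := by
    have h := (div_le_iff₀ (by positivity : (0 : ℝ) < (m : ℝ) ^ 2)).1 hsl
    linarith
  have hC0 : 0 ≤ C := by
    -- from the sliding-scale inequality at `ℓ = m = L`: `χ_L/L² ≤ (C/β) χ_L/L²` with `χ_L ≥ 1`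
    have h := hss L L hL le_rfl
    have hpos : 0 < boxSusceptibility J β L / (L : ℝ) ^ 2 :=
      div_pos (lt_of_lt_of_le zero_lt_one (one_le_boxSusceptibility J β hβ.le hJ L)) (by positivity)
    have h1 : 1 ≤ C / β := by
      by_contra hlt
      push Not at hlt
      have := mul_lt_mul_of_pos_right hlt hpos
      linarith
    have : 0 < C / β := lt_of_lt_of_le zero_lt_one h1
    exact (div_pos_iff_of_pos_right hβ).1 this |>.le
  -- combine
  have hSw2 : pairCorrelation J β 0 w ≤ C * boxSusceptibility J β L / (β * (L : ℝ) ^ 2) * (1 / (8 * m)) := by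
    have hcard0 : (0 : ℝ) < ((2 * m + 1) ^ 3 : ℕ) := by positivity
    have h1 : pairCorrelation J β 0 w ≤ boxSusceptibility J β m / ((2 * m + 1) ^ 3 : ℕ) := by
      rw [le_div_iff₀ hcard0, mul_comm]
      exact hchi
    calc pairCorrelation J β 0 w ≤ boxSusceptibility J β m / ((2 * m + 1) ^ 3 : ℕ) := h1
      _ ≤ C / β * (boxSusceptibility J β L / (L : ℝ) ^ 2) * (m : ℝ) ^ 2 / ((2 * m + 1) ^ 3 : ℕ) :=
          div_le_div_of_nonneg_right hchim hcard0.le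
      _ = C * boxSusceptibility J β L / (β * (L : ℝ) ^ 2) * ((m : ℝ) ^ 2 / ((2 * m + 1 : ℕ) : ℝ) ^ 3) := by
          push_cast
          field_simp
      _ ≤ C * boxSusceptibility J β L / (β * (L : ℝ) ^ 2) * (1 / (8 * m)) :=
          mul_le_mul_of_nonneg_left (sq_div_cube_le hm1) (by positivity)
  -- `1/(8m) ≤ 1/|u|` since `8m ≥ 4n/3 ≥ |u|`
  have h8m : (Site.supNorm u : ℝ) ≤ 8 * m := by
    have : 3 * Site.supNorm u ≤ 24 * m := h4n.trans (by omega)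
    exact_mod_cast (show Site.supNorm u ≤ 8 * m by omega)
  have hfin : 1 / (8 * (m : ℝ)) ≤ 1 / (Site.supNorm u : ℝ) := one_div_le_one_div_of_le hu0 h8m
  rw [← pairCorrelation_zero_sub J β hβ.le hJ hJt u y]
  calc pairCorrelation J β 0 (y - u) = pairCorrelation J β 0 w := by rw [hw]
    _ ≤ C * boxSusceptibility J β L / (β * (L : ℝ) ^ 2) * (1 / (8 * m)) := hSw2
    _ ≤ C * boxSusceptibility J β L / (β * (L : ℝ) ^ 2) * (1 / (Site.supNorm u : ℝ)) :=
        mul_le_mul_of_nonneg_left hfin (by positivity)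
    _ = C * boxSusceptibility J β L / (β * (L : ℝ) ^ 2 * Site.supNorm u) := by
        field_simp

/-- **Infrared bound, far from the box**: if `⟨σ₀σ_x⟩ ≤ C_E |x|_∞^{-(1+η)}` (`x ≠ 0`), then for
`|u|_∞ ≥ 4RL+1` and `y ∈ Λ_{RL}`, `⟨σ_uσ_y⟩ ≤ 3 C_E |u|_∞^{-(1+η)}` (`|u-y| ≥ (3/4)|u|`, `(4/3)^{1+η} ≤ 3`).
[cite: Panis2023Triviality, proof of Theorem 5.5, bound on (2) ("the other two using (5.1)"), p. 22] -/
theorem pairCorrelation_far_le_irb (hβ : 0 ≤ β) (hJ : ∀ x y, 0 ≤ J x y)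
    (hJt : ∀ a x y, J (x + a) (y + a) = J x y) {η : ℝ} (hη0 : 0 ≤ η) (hη2 : η < 2)
    {CE : ℝ} (hE : ∀ x : Site 3, x ≠ 0 → pairCorrelation J β 0 x ≤ CE / ‖x‖ ^ (1 + η))
    {R L : ℕ} {u y : Site 3} (hu : 4 * (R * L) + 1 ≤ Site.supNorm u) (hy : y ∈ box 3 (R * L)) :
    pairCorrelation J β u y ≤ 3 * CE * (Site.supNorm u : ℝ) ^ (-(1 + η)) := by
  set w : Site 3 := y - u with hw
  have hyRL : Site.supNorm y ≤ R * L := mem_box_iff_supNorm_le.1 hy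
  have h4n : 3 * Site.supNorm u ≤ 4 * Site.supNorm w := by
    have h := Site.supNorm_le_supNorm_sub_add u y
    rw [← Site.supNorm_neg (u - y), neg_sub, ← hw] at h
    omega
  have hupos : 0 < Site.supNorm u := by omega
  have hwpos : 0 < Site.supNorm w := by omega
  have hw0 : w ≠ 0 := fun h => by rw [h, Site.supNorm_eq_zero_iff.2 rfl] at hwpos; exact lt_irrefl 0 hwpos
  have hu0 : (0 : ℝ) < Site.supNorm u := by exact_mod_cast hupos
  have hn0 : (0 : ℝ) < Site.supNorm w := by exact_mod_cast hwpos
  -- `C_E ≥ 0` (from the bound at `w`, where `S ≥ 0`)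
  have hEw := hE w hw0
  rw [Site.norm_eq_supNorm] at hEw
  have hCE : 0 ≤ CE := by
    have h0 : 0 ≤ pairCorrelation J β 0 w := pairCorrelation_nonneg J β hβ hJ 0 w
    have h1 : 0 ≤ CE / (Site.supNorm w : ℝ) ^ (1 + η) := h0.trans hEw
    have h2 : 0 < (Site.supNorm w : ℝ) ^ (1 + η) := Real.rpow_pos_of_pos hn0 _
    exact (div_nonneg_iff.1 h1).elim (fun h => h.1) fun h => absurd h.2 (not_le.2 h2)
  have hratio : ((Site.supNorm w : ℝ)) ^ (-(1 + η)) ≤ (4 / 3) ^ (1 + η) * (Site.supNorm u : ℝ) ^ (-(1 + η)) := by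
    have h34 : 3 / 4 * (Site.supNorm u : ℝ) ≤ Site.supNorm w := by
      have : (3 * Site.supNorm u : ℝ) ≤ 4 * Site.supNorm w := by exact_mod_cast h4n
      linarith
    have hpos : 0 < 3 / 4 * (Site.supNorm u : ℝ) := by positivity
    calc ((Site.supNorm w : ℝ)) ^ (-(1 + η)) ≤ (3 / 4 * (Site.supNorm u : ℝ)) ^ (-(1 + η)) :=
          Real.rpow_le_rpow_of_nonpos hpos h34 (by linarith)
      _ = (3 / 4 : ℝ) ^ (-(1 + η)) * (Site.supNorm u : ℝ) ^ (-(1 + η)) := Real.mul_rpow (by norm_num) hu0.le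
      _ = (4 / 3) ^ (1 + η) * (Site.supNorm u : ℝ) ^ (-(1 + η)) := by
          rw [Real.rpow_neg (by norm_num), ← Real.inv_rpow (by norm_num)]
          norm_num
  have h43 : (4 / 3 : ℝ) ^ (1 + η) ≤ 3 := by
    calc (4 / 3 : ℝ) ^ (1 + η) ≤ (4 / 3 : ℝ) ^ (3 : ℝ) :=
          Real.rpow_le_rpow_of_exponent_le (by norm_num) (by linarith)
      _ ≤ 3 := by norm_num
  rw [← pairCorrelation_zero_sub J β hβ hJ hJt u y]
  calc pairCorrelation J β 0 (y - u) = pairCorrelation J β 0 w := by rw [hw]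
    _ ≤ CE / (Site.supNorm w : ℝ) ^ (1 + η) := hEw
    _ = CE * (Site.supNorm w : ℝ) ^ (-(1 + η)) := by rw [Real.rpow_neg hn0.le, div_eq_mul_inv]
    _ ≤ CE * ((4 / 3) ^ (1 + η) * (Site.supNorm u : ℝ) ^ (-(1 + η))) := mul_le_mul_of_nonneg_left hratio hCE
    _ ≤ CE * (3 * (Site.supNorm u : ℝ) ^ (-(1 + η))) :=
        mul_le_mul_of_nonneg_left (mul_le_mul_of_nonneg_right h43 (Real.rpow_nonneg hu0.le _)) hCE
    _ = 3 * CE * (Site.supNorm u : ℝ) ^ (-(1 + η)) := by ring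

end FarBounds

/-! ### The row sums `F(u) = ∑_{y ∈ Λ_{RL}} ⟨σ_uσ_y⟩`, a summable majorant of `F⁴`, and the tree
diagram bound summed over the box -/

section RowSums

variable (J : Site 3 → Site 3 → ℝ) (β : ℝ)

/-- `F_N(u) := ∑_{y ∈ Λ_N} ⟨σ_uσ_y⟩_β` (the inner sums of (1) and (2), p. 22). [cite: Panis2023Triviality, proof of Theorem 5.5, bound on (1) (first display), p. 22] -/
def boxRowSum (N : ℕ) (u : Site 3) : ℝ := ∑ y ∈ box 3 N, pairCorrelation J β u y

/-- `F_N(u) ≥ 0`. [folklore] -/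
theorem boxRowSum_nonneg (hβ : 0 ≤ β) (hJ : ∀ x y, 0 ≤ J x y) (N : ℕ) (u : Site 3) : 0 ≤ boxRowSum J β N u :=
  Finset.sum_nonneg fun y _ => pairCorrelation_nonneg J β hβ hJ u y

/-- **Near the box** (bound on (1)): for `u ∈ Λ_{4RL}`, `F_{RL}(u) ≤ χ_{5RL}(β) ≤ 25 C R² χ_L(β)/β`
(translation invariance, then the sliding-scale bound between the scales `L` and `5RL`).
[cite: Panis2023Triviality, proof of Theorem 5.5, bound on (1), p. 22] -/
theorem boxRowSum_le_near (hβ : 0 < β) (hJ : ∀ x y, 0 ≤ J x y) (hJt : ∀ a x y, J (x + a) (y + a) = J x y)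
    {C : ℝ} (hss : ∀ ℓ m : ℕ, 1 ≤ ℓ → ℓ ≤ m →
      boxSusceptibility J β m / (m : ℝ) ^ 2 ≤ C / β * (boxSusceptibility J β ℓ / (ℓ : ℝ) ^ 2))
    {R L : ℕ} (hR : 1 ≤ R) (hL : 1 ≤ L) {u : Site 3} (hu : u ∈ box 3 (4 * (R * L))) :
    boxRowSum J β (R * L) u ≤ 25 * C * (R : ℝ) ^ 2 * boxSusceptibility J β L / β := by
  have hRL : 1 ≤ R * L := Nat.one_le_iff_ne_zero.2 (Nat.mul_ne_zero (by omega) (by omega))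
  have h1 : boxRowSum J β (R * L) u ≤ boxSusceptibility J β (5 * (R * L)) := by
    have h := sum_box_pairCorrelation_le J β hβ.le hJ hJt (N := R * L) hu
    rwa [show R * L + 4 * (R * L) = 5 * (R * L) by ring] at h
  have h2 := hss L (5 * (R * L)) hL (by nlinarith)
  have hpos : (0 : ℝ) < ((5 * (R * L) : ℕ) : ℝ) ^ 2 := by positivity
  have h3 : boxSusceptibility J β (5 * (R * L)) ≤ C / β * (boxSusceptibility J β L / (L : ℝ) ^ 2) * ((5 * (R * L) : ℕ) : ℝ) ^ 2 := by
    have h := (div_le_iff₀ hpos).1 h2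
    linarith
  have hL0 : (0 : ℝ) < L := by exact_mod_cast hL
  calc boxRowSum J β (R * L) u ≤ boxSusceptibility J β (5 * (R * L)) := h1
    _ ≤ C / β * (boxSusceptibility J β L / (L : ℝ) ^ 2) * ((5 * (R * L) : ℕ) : ℝ) ^ 2 := h3
    _ = 25 * C * (R : ℝ) ^ 2 * boxSusceptibility J β L / β := by
        push_cast
        field_simp
        norm_num

/-- **Far from the box** (bound on (2)): for `|u|_∞ ≥ 4RL+1`, `F_{RL}(u)⁴ ≤ B |u|_∞^{-(4+2η)}` with
`B = 9 C² C_E² (2RL+1)^{12} χ_L² / (β² L⁴)` (two factors through MMS + sliding scale, two through the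
infrared bound). [cite: Panis2023Triviality, proof of Theorem 5.5, bound on (2), p. 22] -/
theorem boxRowSum_pow_four_le_far (hβ : 0 < β) (hJ : ∀ x y, 0 ≤ J x y)
    (hJt : ∀ a x y, J (x + a) (y + a) = J x y)
    (hmms : ∀ x y : Site 3, (3 : ℝ) * ‖x‖ ≤ ‖y‖ → pairCorrelation J β 0 y ≤ pairCorrelation J β 0 x)
    {C : ℝ} (hss : ∀ ℓ m : ℕ, 1 ≤ ℓ → ℓ ≤ m →
      boxSusceptibility J β m / (m : ℝ) ^ 2 ≤ C / β * (boxSusceptibility J β ℓ / (ℓ : ℝ) ^ 2))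
    {η : ℝ} (hη0 : 0 ≤ η) (hη2 : η < 2)
    {CE : ℝ} (hE : ∀ x : Site 3, x ≠ 0 → pairCorrelation J β 0 x ≤ CE / ‖x‖ ^ (1 + η))
    {R L : ℕ} (hR : 1 ≤ R) (hL : 1 ≤ L) {u : Site 3} (hu : 4 * (R * L) + 1 ≤ Site.supNorm u) :
    boxRowSum J β (R * L) u ^ 4 ≤
      9 * C ^ 2 * CE ^ 2 * ((2 * (R * L) + 1 : ℕ) : ℝ) ^ 12 * boxSusceptibility J β L ^ 2 / (β ^ 2 * (L : ℝ) ^ 4) *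
        (Site.supNorm u : ℝ) ^ (-(4 + 2 * η)) := by
  set V : ℝ := ((2 * (R * L) + 1 : ℕ) : ℝ) ^ 3 with hV
  set Nu : ℝ := (Site.supNorm u : ℝ) with hNu
  have hupos : 0 < Site.supNorm u := by omega
  have hNu0 : 0 < Nu := by rw [hNu]; exact_mod_cast hupos
  have hL0 : (0 : ℝ) < L := by exact_mod_cast hL
  set b₁ : ℝ := C * boxSusceptibility J β L / (β * (L : ℝ) ^ 2 * Nu) with hb₁
  set b₂ : ℝ := 3 * CE * Nu ^ (-(1 + η)) with hb₂
  have hF0 : 0 ≤ boxRowSum J β (R * L) u := boxRowSum_nonneg J β hβ.le hJ _ u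
  have hcard : (#(box 3 (R * L)) : ℝ) = V := by rw [card_box, hV]; norm_cast
  have hF1 : boxRowSum J β (R * L) u ≤ V * b₁ := by
    rw [boxRowSum, ← hcard, ← nsmul_eq_mul, ← Finset.sum_const]
    exact Finset.sum_le_sum fun y hy => pairCorrelation_far_le_sliding J β hβ hJ hJt hmms hss hR hL hu hy
  have hF2 : boxRowSum J β (R * L) u ≤ V * b₂ := by
    rw [boxRowSum, ← hcard, ← nsmul_eq_mul, ← Finset.sum_const]
    exact Finset.sum_le_sum fun y hy => pairCorrelation_far_le_irb J β hβ.le hJ hJt hη0 hη2 hE hu hy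
  have hsq1 : boxRowSum J β (R * L) u ^ 2 ≤ (V * b₁) ^ 2 := pow_le_pow_left₀ hF0 hF1 2
  have hsq2 : boxRowSum J β (R * L) u ^ 2 ≤ (V * b₂) ^ 2 := pow_le_pow_left₀ hF0 hF2 2
  have h4 : boxRowSum J β (R * L) u ^ 4 ≤ (V * b₁) ^ 2 * (V * b₂) ^ 2 := by
    rw [show boxRowSum J β (R * L) u ^ 4 = boxRowSum J β (R * L) u ^ 2 * boxRowSum J β (R * L) u ^ 2 by ring]
    exact mul_le_mul hsq1 hsq2 (sq_nonneg _) (sq_nonneg _)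
  refine h4.trans (le_of_eq ?_)
  rw [hb₁, hb₂, hV]
  have hpow : Nu ^ (-(4 + 2 * η)) = (Nu ^ 2)⁻¹ * (Nu ^ (-(1 + η))) ^ 2 := by
    rw [← Real.rpow_natCast (Nu ^ (-(1 + η))) 2, ← Real.rpow_mul hNu0.le, ← Real.rpow_natCast Nu 2,
      ← Real.rpow_neg hNu0.le, ← Real.rpow_add hNu0]
    norm_num
    ring_nf
  rw [hpow]
  field_simp
  ring

/-- The majorant of `F_{RL}(u)⁴`: `A` on `Λ_M`, `B |u|_∞^{-q}` outside. [folklore] -/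
def rowMajorant (A B q : ℝ) (M : ℕ) (u : Site 3) : ℝ :=
  if u ∈ box 3 M then A else B * (Site.supNorm u : ℝ) ^ (-q)

/-- The majorant is nonnegative for `A, B ≥ 0`. [folklore] -/
theorem rowMajorant_nonneg {A B : ℝ} (hA : 0 ≤ A) (hB : 0 ≤ B) (q : ℝ) (M : ℕ) (u : Site 3) :
    0 ≤ rowMajorant A B q M u := by
  unfold rowMajorant
  split_ifs
  · exact hA
  · exact mul_nonneg hB (Real.rpow_nonneg (Nat.cast_nonneg _) _)

/-- **Finite sums of the majorant are uniformly bounded**: for `q > 3`, `M ≥ 1` and every finite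
`s ⊆ ℤ³`, `∑_{u∈s} (A 1_{Λ_M} + B|u|^{-q} 1_{Λ_Mᶜ}) ≤ |Λ_M| A + 26 B M^{3-q}/(q-3)`. [folklore] -/
theorem sum_rowMajorant_le {A B q : ℝ} (hA : 0 ≤ A) (hB : 0 ≤ B) (hq : 3 < q) {M : ℕ} (hM : 1 ≤ M)
    (s : Finset (Site 3)) :
    ∑ u ∈ s, rowMajorant A B q M u ≤ (#(box 3 M) : ℝ) * A + B * (26 * (M : ℝ) ^ (3 - q) / (q - 3)) := by
  obtain ⟨N₀, hN₀⟩ := exists_forall_subset_box 3 s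
  set N : ℕ := max N₀ M with hN
  have hsN : s ⊆ box 3 N := hN₀ N (le_max_left _ _)
  have hMN : M ≤ N := le_max_right _ _
  have h0 : ∀ u, 0 ≤ rowMajorant A B q M u := rowMajorant_nonneg hA hB q M
  calc ∑ u ∈ s, rowMajorant A B q M u ≤ ∑ u ∈ box 3 N, rowMajorant A B q M u :=
        Finset.sum_le_sum_of_subset_of_nonneg hsN fun u _ _ => h0 u
    _ = ∑ u ∈ box 3 N \ box 3 M, rowMajorant A B q M u + ∑ u ∈ box 3 M, rowMajorant A B q M u :=
        (Finset.sum_sdiff (box_mono 3 hMN)).symm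
    _ = B * ∑ u ∈ box 3 N \ box 3 M, (Site.supNorm u : ℝ) ^ (-q) + (#(box 3 M) : ℝ) * A := by
        congr 1
        · rw [Finset.mul_sum]
          refine Finset.sum_congr rfl fun u hu => ?_
          rw [rowMajorant, if_neg (Finset.mem_sdiff.1 hu).2]
        · rw [Finset.sum_congr rfl fun u hu => by rw [rowMajorant, if_pos hu], Finset.sum_const, nsmul_eq_mul]
    _ ≤ B * (26 * (M : ℝ) ^ (3 - q) / (q - 3)) + (#(box 3 M) : ℝ) * A := by
        have h := sum_box_sdiff_rpow_supNorm_le hq hM N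
        nlinarith
    _ = (#(box 3 M) : ℝ) * A + B * (26 * (M : ℝ) ^ (3 - q) / (q - 3)) := by ring

/-- The majorant is summable over `ℤ³`, with the same bound on its sum. [folklore] -/
theorem summable_rowMajorant {A B q : ℝ} (hA : 0 ≤ A) (hB : 0 ≤ B) (hq : 3 < q) {M : ℕ} (hM : 1 ≤ M) :
    Summable (rowMajorant A B q M) ∧
      ∑' u, rowMajorant A B q M u ≤ (#(box 3 M) : ℝ) * A + B * (26 * (M : ℝ) ^ (3 - q) / (q - 3)) :=
  ⟨summable_of_sum_le (rowMajorant_nonneg hA hB q M) (sum_rowMajorant_le hA hB hq hM),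
    Real.tsum_le_of_sum_le (rowMajorant_nonneg hA hB q M) (sum_rowMajorant_le hA hB hq hM)⟩

/-- One quadruple: the tree diagram bound with the product written over `Fin 4`. [folklore] -/
theorem treeDiagram_prod_form (hβ : 0 ≤ β) (hJ : ∀ x y, 0 ≤ J x y)
    (hT : ∀ x y z t : Site 3, ENNReal.ofReal |ursellFour J β x y z t| ≤
      2 * ∑' u : Site 3, ENNReal.ofReal (pairCorrelation J β x u * pairCorrelation J β y u *
        pairCorrelation J β z u * pairCorrelation J β t u))
    (x : Fin 4 → Site 3) :
    ENNReal.ofReal |ursellFour J β (x 0) (x 1) (x 2) (x 3)| ≤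
      2 * ∑' u : Site 3, ∏ i : Fin 4, ENNReal.ofReal (pairCorrelation J β (x i) u) := by
  have hS0 : ∀ x u, 0 ≤ pairCorrelation J β x u := fun x u => pairCorrelation_nonneg J β hβ hJ x u
  have hprod : ∀ u : Site 3, ∏ i : Fin 4, ENNReal.ofReal (pairCorrelation J β (x i) u) =
      ENNReal.ofReal (pairCorrelation J β (x 0) u * pairCorrelation J β (x 1) u *
        pairCorrelation J β (x 2) u * pairCorrelation J β (x 3) u) := by
    intro u
    rw [Fin.prod_univ_four, ENNReal.ofReal_mul (mul_nonneg (mul_nonneg (hS0 _ _) (hS0 _ _)) (hS0 _ _)),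
      ENNReal.ofReal_mul (mul_nonneg (hS0 _ _) (hS0 _ _)), ENNReal.ofReal_mul (hS0 _ _)]
  simp_rw [hprod]
  exact hT (x 0) (x 1) (x 2) (x 3)

/-- The sum over `Λ_N⁴` of `∏ᵢ ⟨σ_{xᵢ}σ_u⟩` is `F_N(u)⁴` (in `ℝ≥0∞`). [folklore] -/
theorem sum_piFinset_prod_eq (hβ : 0 ≤ β) (hJ : ∀ x y, 0 ≤ J x y) (N : ℕ) (u : Site 3) :
    ∑ x ∈ Fintype.piFinset (fun _ : Fin 4 => box 3 N), ∏ i : Fin 4, ENNReal.ofReal (pairCorrelation J β (x i) u) =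
      ENNReal.ofReal (boxRowSum J β N u ^ 4) := by
  have hS0 : ∀ x u, 0 ≤ pairCorrelation J β x u := fun x u => pairCorrelation_nonneg J β hβ hJ x u
  have h1 : ∑ x ∈ Fintype.piFinset (fun _ : Fin 4 => box 3 N), ∏ i : Fin 4, ENNReal.ofReal (pairCorrelation J β (x i) u) =
      ∏ _i : Fin 4, ∑ y ∈ box 3 N, ENNReal.ofReal (pairCorrelation J β y u) :=
    (Finset.prod_univ_sum (fun _ : Fin 4 => box 3 N) fun _ y => ENNReal.ofReal (pairCorrelation J β y u)).symm
  have h2 : ∑ y ∈ box 3 N, ENNReal.ofReal (pairCorrelation J β y u) = ENNReal.ofReal (boxRowSum J β N u) := by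
    rw [boxRowSum, ENNReal.ofReal_sum_of_nonneg fun y _ => hS0 u y]
    exact Finset.sum_congr rfl fun y _ => by rw [pairCorrelation_comm J β y u]
  rw [h1, Finset.prod_const, Finset.card_univ, Fintype.card_fin, h2,
    ENNReal.ofReal_pow (boxRowSum_nonneg J β hβ hJ N u)]

/-- **The tree diagram bound summed over the box**: if `|U₄| ≤ 2∑_u ∏⟨σ_{xᵢ}σ_u⟩` (in `ℝ≥0∞`) and
`F_N(u)⁴ ≤ g(u)` with `g ≥ 0` summable, then `∑_{x∈Λ_N⁴} |U₄(x)| ≤ 2 ∑_u g(u)`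
("`S(β,L,f) ≤ 2∑_x ∑_{x₁,…,x₄}⟨σ_xσ_{x₁}⟩⋯⟨σ_xσ_{x₄}⟩/Σ_L² = 2∑_x (∑_y⟨σ_xσ_y⟩)⁴/Σ_L²`", p. 22).
[cite: Panis2023Triviality, proof of Theorem 5.5 ("Applying the tree diagram bound"), pp. 21–22] -/
theorem sum_abs_ursellFour_le (hβ : 0 ≤ β) (hJ : ∀ x y, 0 ≤ J x y)
    (hT : ∀ x y z t : Site 3, ENNReal.ofReal |ursellFour J β x y z t| ≤
      2 * ∑' u : Site 3, ENNReal.ofReal (pairCorrelation J β x u * pairCorrelation J β y u *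
        pairCorrelation J β z u * pairCorrelation J β t u))
    {N : ℕ} {g : Site 3 → ℝ} (hg0 : ∀ u, 0 ≤ g u) (hgs : Summable g) (hFg : ∀ u, boxRowSum J β N u ^ 4 ≤ g u) :
    ∑ x ∈ Fintype.piFinset (fun _ : Fin 4 => box 3 N), |ursellFour J β (x 0) (x 1) (x 2) (x 3)| ≤ 2 * ∑' u, g u := by
  set P : Finset (Fin 4 → Site 3) := Fintype.piFinset (fun _ : Fin 4 => box 3 N) with hP
  set Φ : (Fin 4 → Site 3) → Site 3 → ℝ≥0∞ := fun x u => ∏ i : Fin 4, ENNReal.ofReal (pairCorrelation J β (x i) u) with hΦ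
  have step1 : ∑ x ∈ P, ENNReal.ofReal |ursellFour J β (x 0) (x 1) (x 2) (x 3)| ≤ ∑ x ∈ P, 2 * ∑' u : Site 3, Φ x u :=
    Finset.sum_le_sum fun x _ => treeDiagram_prod_form J β hβ hJ hT x
  have step2 : ∑ x ∈ P, 2 * ∑' u : Site 3, Φ x u = 2 * ∑' u : Site 3, ∑ x ∈ P, Φ x u := by
    rw [← Finset.mul_sum, Summable.tsum_finsetSum fun _ _ => ENNReal.summable]
  have step3 : ∑' u : Site 3, ∑ x ∈ P, Φ x u ≤ ∑' u : Site 3, ENNReal.ofReal (g u) := by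
    refine ENNReal.tsum_le_tsum fun u => ?_
    rw [hΦ, hP, sum_piFinset_prod_eq J β hβ hJ N u]
    exact ENNReal.ofReal_le_ofReal (hFg u)
  have step4 : ∑' u : Site 3, ENNReal.ofReal (g u) = ENNReal.ofReal (∑' u, g u) :=
    (ENNReal.ofReal_tsum_of_nonneg hg0 hgs).symm
  have hsum : ENNReal.ofReal (∑ x ∈ P, |ursellFour J β (x 0) (x 1) (x 2) (x 3)|) ≤ ENNReal.ofReal (2 * ∑' u, g u) := by
    rw [ENNReal.ofReal_sum_of_nonneg fun x _ => abs_nonneg _, ENNReal.ofReal_mul (by norm_num : (0:ℝ) ≤ 2),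
      ENNReal.ofReal_ofNat, ← step4]
    exact step1.trans (step2.le.trans (by gcongr))
  exact (ENNReal.ofReal_le_ofReal_iff (mul_nonneg (by norm_num) (tsum_nonneg hg0))).1 hsum

end RowSums

/-! ### Bookkeeping of the powers of `L`, `R`, `β` (p. 22, last lines of the bounds on (1) and (2)) -/

section Algebra

/-- `L^{-6} = ((L³)⁻¹)²` for `L > 0` (real versus natural powers). [folklore] -/
theorem rpow_neg_six_eq {L : ℝ} (hL : 0 < L) : L ^ (-6 : ℝ) = ((L ^ 3)⁻¹) ^ 2 := by
  rw [show ((L ^ 3)⁻¹) ^ 2 = (L ^ 6)⁻¹ by rw [inv_pow, ← pow_mul], Real.rpow_neg hL.le]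
  congr 1
  exact_mod_cast Real.rpow_natCast L 6

/-- `L³ · (L^{2-η})² · (L³)⁻² = L^{1-2η}` for `L > 0`. [folklore] -/
theorem rpow_bookkeeping_near {L : ℝ} (hL : 0 < L) (η : ℝ) :
    L ^ 3 * (L ^ (2 - η)) ^ 2 * ((L ^ 3)⁻¹) ^ 2 = L ^ (1 - 2 * η) := by
  have h1 : L ^ (3 : ℝ) = L ^ 3 := by exact_mod_cast Real.rpow_natCast L 3
  have h2 : L ^ (2 * (2 - η)) = (L ^ (2 - η)) ^ 2 := by rw [mul_comm, Real.rpow_mul hL.le, Real.rpow_two]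
  rw [show (1 : ℝ) - 2 * η = 3 + 2 * (2 - η) + (-6) by ring, Real.rpow_add hL, Real.rpow_add hL, h1, h2,
    rpow_neg_six_eq hL]

/-- `L¹² · (L⁴)⁻¹ · L^{-(1+2η)} · (L³)⁻² = L^{1-2η}` for `L > 0`. [folklore] -/
theorem rpow_bookkeeping_far {L : ℝ} (hL : 0 < L) (η : ℝ) :
    L ^ 12 * (L ^ 4)⁻¹ * L ^ (-(1 + 2 * η)) * ((L ^ 3)⁻¹) ^ 2 = L ^ (1 - 2 * η) := by
  have h1 : L ^ (12 : ℝ) = L ^ 12 := by exact_mod_cast Real.rpow_natCast L 12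
  have h2 : L ^ (-4 : ℝ) = (L ^ 4)⁻¹ := by
    rw [Real.rpow_neg hL.le]
    congr 1
    exact_mod_cast Real.rpow_natCast L 4
  rw [show (1 : ℝ) - 2 * η = 12 + (-4) + (-(1 + 2 * η)) + (-6) by ring, Real.rpow_add hL, Real.rpow_add hL,
    Real.rpow_add hL, h1, h2, rpow_neg_six_eq hL]

/-- **The near term** of `S(β,L,f)`: `2|Λ_{4RL}|(25 C R² χ_L/β)⁴/Σ_L² ≤ K₁ β⁻⁴ R¹¹ L^{1-2η}` granted
`χ_L ≤ C₄L^{2-η}` and `χ_L ≤ C₂L^{-3}Σ_L`, with `K₁ = 2·729·(25C)⁴C₄²C₂²`.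
[cite: Panis2023Triviality, proof of Theorem 5.5, bound on (1) (last two displays), p. 22] -/
theorem near_term_le {C C₂ C₄ χ V β η : ℝ} {R L : ℕ} (hχ0 : 0 ≤ χ) (hV : 1 ≤ V) (hβ : 0 < β)
    (hR : 1 ≤ R) (hL : 1 ≤ L) (hχ4 : χ ≤ C₄ * (L : ℝ) ^ (2 - η)) (hχV : χ ≤ C₂ * ((L : ℝ) ^ 3)⁻¹ * V) :
    2 * (#(box 3 (4 * (R * L))) : ℝ) * (25 * C * (R : ℝ) ^ 2 * χ / β) ^ 4 / V ^ 2 ≤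
      (2 * 729 * (25 * C) ^ 4 * C₄ ^ 2 * C₂ ^ 2) * β ^ (-(4 : ℝ)) * (R : ℝ) ^ (11 : ℝ) * (L : ℝ) ^ (1 - 2 * η) := by
  have hR0 : (0 : ℝ) < R := by exact_mod_cast hR
  have hL0 : (0 : ℝ) < L := by exact_mod_cast hL
  have hV0 : 0 < V := by linarith
  have hC₄ : 0 ≤ C₄ * (L : ℝ) ^ (2 - η) := hχ0.trans hχ4
  have hratio : χ / V ≤ C₂ * ((L : ℝ) ^ 3)⁻¹ := by
    rw [div_le_iff₀ hV0]
    exact hχV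
  have hratio0 : 0 ≤ χ / V := div_nonneg hχ0 hV0.le
  have hcard : (#(box 3 (4 * (R * L))) : ℝ) ≤ 729 * (R : ℝ) ^ 3 * (L : ℝ) ^ 3 := by
    rw [card_box]
    push_cast
    have h1 : (1 : ℝ) ≤ R * L := by
      have := mul_le_mul (show (1:ℝ) ≤ R by exact_mod_cast hR) (show (1:ℝ) ≤ L by exact_mod_cast hL) zero_le_one hR0.le
      linarith
    nlinarith [h1, mul_pos hR0 hL0, sq_nonneg ((R : ℝ) * L)]
  have e1 : 2 * (#(box 3 (4 * (R * L))) : ℝ) * (25 * C * (R : ℝ) ^ 2 * χ / β) ^ 4 / V ^ 2 =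
      2 * (#(box 3 (4 * (R * L))) : ℝ) * ((25 * C) ^ 4 * (R : ℝ) ^ 8 * (β ^ 4)⁻¹) * (χ ^ 2 * (χ / V) ^ 2) := by
    field_simp
  rw [e1]
  have hsq1 : χ ^ 2 ≤ (C₄ * (L : ℝ) ^ (2 - η)) ^ 2 := pow_le_pow_left₀ hχ0 hχ4 2
  have hsq2 : (χ / V) ^ 2 ≤ (C₂ * ((L : ℝ) ^ 3)⁻¹) ^ 2 := pow_le_pow_left₀ hratio0 hratio 2
  calc 2 * (#(box 3 (4 * (R * L))) : ℝ) * ((25 * C) ^ 4 * (R : ℝ) ^ 8 * (β ^ 4)⁻¹) * (χ ^ 2 * (χ / V) ^ 2)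
      ≤ 2 * (729 * (R : ℝ) ^ 3 * (L : ℝ) ^ 3) * ((25 * C) ^ 4 * (R : ℝ) ^ 8 * (β ^ 4)⁻¹) *
          ((C₄ * (L : ℝ) ^ (2 - η)) ^ 2 * (C₂ * ((L : ℝ) ^ 3)⁻¹) ^ 2) := by
        gcongr
    _ = (2 * 729 * (25 * C) ^ 4 * C₄ ^ 2 * C₂ ^ 2) * (β ^ 4)⁻¹ * ((R : ℝ) ^ 3 * (R : ℝ) ^ 8) *
          ((L : ℝ) ^ 3 * ((L : ℝ) ^ (2 - η)) ^ 2 * (((L : ℝ) ^ 3)⁻¹) ^ 2) := by ring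
    _ = (2 * 729 * (25 * C) ^ 4 * C₄ ^ 2 * C₂ ^ 2) * β ^ (-(4 : ℝ)) * (R : ℝ) ^ (11 : ℝ) * (L : ℝ) ^ (1 - 2 * η) := by
        rw [rpow_bookkeeping_near hL0, ← pow_add, Real.rpow_neg hβ.le, show (11 : ℝ) = ((11 : ℕ) : ℝ) by norm_num,
          Real.rpow_natCast, show (4 : ℝ) = ((4 : ℕ) : ℝ) by norm_num, Real.rpow_natCast]

/-- **The far term** of `S(β,L,f)`: `2 B_far · 26(4RL)^{3-q}/(q-3) / Σ_L² ≤ K₂ β⁻² R¹¹ L^{1-2η}` with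
`B_far = 9C²C_E²(2RL+1)¹²χ_L²/(β²L⁴)`, `q = 4+2η`, granted `χ_L ≤ C₂L^{-3}Σ_L`, with
`K₂ = 2·26·9·3¹²C²C_E²C₂²/(1+2η)`. [cite: Panis2023Triviality, proof of Theorem 5.5, bound on (2) (last display), p. 22] -/
theorem far_term_le {C CE C₂ χ V β η : ℝ} {R L : ℕ} (hχ0 : 0 ≤ χ) (hV : 1 ≤ V) (hβ : 0 < β) (hη0 : 0 ≤ η)
    (hR : 1 ≤ R) (hL : 1 ≤ L) (hχV : χ ≤ C₂ * ((L : ℝ) ^ 3)⁻¹ * V) :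
    2 * (9 * C ^ 2 * CE ^ 2 * ((2 * (R * L) + 1 : ℕ) : ℝ) ^ 12 * χ ^ 2 / (β ^ 2 * (L : ℝ) ^ 4)) *
        (26 * (((4 * (R * L) : ℕ) : ℝ)) ^ (3 - (4 + 2 * η)) / (4 + 2 * η - 3)) / V ^ 2 ≤
      (2 * 26 * 9 * 3 ^ 12 * C ^ 2 * CE ^ 2 * C₂ ^ 2 / (1 + 2 * η)) * β ^ (-(2 : ℝ)) * (R : ℝ) ^ (11 : ℝ) *
        (L : ℝ) ^ (1 - 2 * η) := by
  have hR0 : (0 : ℝ) < R := by exact_mod_cast hR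
  have hL0 : (0 : ℝ) < L := by exact_mod_cast hL
  have hR1 : (1 : ℝ) ≤ R := by exact_mod_cast hR
  have hV0 : 0 < V := by linarith
  have hη1 : 0 < 1 + 2 * η := by linarith
  have hratio : χ / V ≤ C₂ * ((L : ℝ) ^ 3)⁻¹ := by
    rw [div_le_iff₀ hV0]
    exact hχV
  have hratio0 : 0 ≤ χ / V := div_nonneg hχ0 hV0.le
  have hsq2 : (χ / V) ^ 2 ≤ (C₂ * ((L : ℝ) ^ 3)⁻¹) ^ 2 := pow_le_pow_left₀ hratio0 hratio 2
  have hvol : ((2 * (R * L) + 1 : ℕ) : ℝ) ^ 12 ≤ (3 : ℝ) ^ 12 * (R : ℝ) ^ 12 * (L : ℝ) ^ 12 := by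
    have h1 : ((2 * (R * L) + 1 : ℕ) : ℝ) ≤ 3 * ((R : ℝ) * L) := by
      push_cast
      have : (1 : ℝ) ≤ (R : ℝ) * L := by
        have := mul_le_mul hR1 (show (1:ℝ) ≤ L by exact_mod_cast hL) zero_le_one hR0.le
        linarith
      linarith
    calc ((2 * (R * L) + 1 : ℕ) : ℝ) ^ 12 ≤ (3 * ((R : ℝ) * L)) ^ 12 := pow_le_pow_left₀ (by positivity) h1 12
      _ = (3 : ℝ) ^ 12 * (R : ℝ) ^ 12 * (L : ℝ) ^ 12 := by ring
  -- `(4RL)^{3-q} = (4RL)^{-(1+2η)} ≤ R^{-(1+2η)} L^{-(1+2η)}`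
  have hM : (((4 * (R * L) : ℕ) : ℝ)) ^ (3 - (4 + 2 * η)) ≤ (R : ℝ) ^ (-(1 + 2 * η)) * (L : ℝ) ^ (-(1 + 2 * η)) := by
    have e : (3 : ℝ) - (4 + 2 * η) = -(1 + 2 * η) := by ring
    rw [e]
    push_cast
    rw [show (4 : ℝ) * ((R : ℝ) * L) = 4 * ((R : ℝ) * L) by ring, Real.mul_rpow (by norm_num) (by positivity),
      Real.mul_rpow hR0.le hL0.le]
    have h4 : (4 : ℝ) ^ (-(1 + 2 * η)) ≤ 1 := Real.rpow_le_one_of_one_le_of_nonpos (by norm_num) (by linarith)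
    have hrest : 0 ≤ (R : ℝ) ^ (-(1 + 2 * η)) * (L : ℝ) ^ (-(1 + 2 * η)) :=
      mul_nonneg (Real.rpow_nonneg hR0.le _) (Real.rpow_nonneg hL0.le _)
    calc (4 : ℝ) ^ (-(1 + 2 * η)) * ((R : ℝ) ^ (-(1 + 2 * η)) * (L : ℝ) ^ (-(1 + 2 * η)))
        ≤ 1 * ((R : ℝ) ^ (-(1 + 2 * η)) * (L : ℝ) ^ (-(1 + 2 * η))) := mul_le_mul_of_nonneg_right h4 hrest
      _ = (R : ℝ) ^ (-(1 + 2 * η)) * (L : ℝ) ^ (-(1 + 2 * η)) := one_mul _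
  have hM0 : 0 ≤ (((4 * (R * L) : ℕ) : ℝ)) ^ (3 - (4 + 2 * η)) := Real.rpow_nonneg (Nat.cast_nonneg _) _
  -- `R^{12} R^{-(1+2η)} ≤ R^{11}`
  have hRpow : (R : ℝ) ^ 12 * (R : ℝ) ^ (-(1 + 2 * η)) ≤ (R : ℝ) ^ (11 : ℝ) := by
    rw [← Real.rpow_natCast (R : ℝ) 12, ← Real.rpow_add hR0]
    exact Real.rpow_le_rpow_of_exponent_le hR1 (by norm_num; linarith)
  have e1 : 2 * (9 * C ^ 2 * CE ^ 2 * ((2 * (R * L) + 1 : ℕ) : ℝ) ^ 12 * χ ^ 2 / (β ^ 2 * (L : ℝ) ^ 4)) *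
        (26 * (((4 * (R * L) : ℕ) : ℝ)) ^ (3 - (4 + 2 * η)) / (4 + 2 * η - 3)) / V ^ 2 =
      (2 * 26 * 9 * C ^ 2 * CE ^ 2 / (1 + 2 * η)) * (β ^ 2)⁻¹ * (((2 * (R * L) + 1 : ℕ) : ℝ) ^ 12 *
        ((((4 * (R * L) : ℕ) : ℝ)) ^ (3 - (4 + 2 * η)) * (((L : ℝ) ^ 4)⁻¹ * (χ / V) ^ 2))) := by
    rw [show (4 : ℝ) + 2 * η - 3 = 1 + 2 * η by ring]
    field_simp
  rw [e1]
  calc (2 * 26 * 9 * C ^ 2 * CE ^ 2 / (1 + 2 * η)) * (β ^ 2)⁻¹ * (((2 * (R * L) + 1 : ℕ) : ℝ) ^ 12 *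
        ((((4 * (R * L) : ℕ) : ℝ)) ^ (3 - (4 + 2 * η)) * (((L : ℝ) ^ 4)⁻¹ * (χ / V) ^ 2)))
      ≤ (2 * 26 * 9 * C ^ 2 * CE ^ 2 / (1 + 2 * η)) * (β ^ 2)⁻¹ * (((3 : ℝ) ^ 12 * (R : ℝ) ^ 12 * (L : ℝ) ^ 12) *
        (((R : ℝ) ^ (-(1 + 2 * η)) * (L : ℝ) ^ (-(1 + 2 * η))) * (((L : ℝ) ^ 4)⁻¹ * (C₂ * ((L : ℝ) ^ 3)⁻¹) ^ 2))) := by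
        gcongr
    _ = (2 * 26 * 9 * 3 ^ 12 * C ^ 2 * CE ^ 2 * C₂ ^ 2 / (1 + 2 * η)) * (β ^ 2)⁻¹ *
        ((R : ℝ) ^ 12 * (R : ℝ) ^ (-(1 + 2 * η))) *
        ((L : ℝ) ^ 12 * ((L : ℝ) ^ 4)⁻¹ * (L : ℝ) ^ (-(1 + 2 * η)) * (((L : ℝ) ^ 3)⁻¹) ^ 2) := by ring
    _ ≤ (2 * 26 * 9 * 3 ^ 12 * C ^ 2 * CE ^ 2 * C₂ ^ 2 / (1 + 2 * η)) * (β ^ 2)⁻¹ * (R : ℝ) ^ (11 : ℝ) *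
        ((L : ℝ) ^ 12 * ((L : ℝ) ^ 4)⁻¹ * (L : ℝ) ^ (-(1 + 2 * η)) * (((L : ℝ) ^ 3)⁻¹) ^ 2) := by
        gcongr
    _ = (2 * 26 * 9 * 3 ^ 12 * C ^ 2 * CE ^ 2 * C₂ ^ 2 / (1 + 2 * η)) * β ^ (-(2 : ℝ)) * (R : ℝ) ^ (11 : ℝ) *
        (L : ℝ) ^ (1 - 2 * η) := by
        rw [rpow_bookkeeping_far hL0, Real.rpow_neg hβ.le, show (2 : ℝ) = ((2 : ℕ) : ℝ) by norm_num, Real.rpow_natCast]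

end Algebra

/-! ### `S(β,L,f)` for `d = 3` from the two-point-level facts -/

section Main

variable (J : Site 3 → Site 3 → ℝ) (β : ℝ)

/-- **`χ_L ≤ C₄ L^{2-η}` from the infrared bound** (`C₄ = 1 + 26C_E(1 + 1/(2-η))`): the term `x = 0`
plus `C_E ∑_{x∈Λ_L∖0} |x|_∞^{-(1+η)}`. [cite: Panis2023Triviality, proof of Theorem 5.5, bound on (1) ("χ_L(β) ≤ C_4 L^{2-η}"), p. 22] -/
theorem boxSusceptibility_le_of_irb (hβ : 0 ≤ β) (hJ : ∀ x y, 0 ≤ J x y) {η : ℝ} (hη2 : η < 2)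
    {CE : ℝ} (hCE : 0 ≤ CE) (hE : ∀ x : Site 3, x ≠ 0 → pairCorrelation J β 0 x ≤ CE / ‖x‖ ^ (1 + η))
    {L : ℕ} (hL : 1 ≤ L) :
    boxSusceptibility J β L ≤ (1 + 26 * CE * (1 + 1 / (2 - η))) * (L : ℝ) ^ (2 - η) := by
  have hL0 : (0 : ℝ) < L := by exact_mod_cast hL
  have hLp : 1 ≤ (L : ℝ) ^ (2 - η) := Real.one_le_rpow (by exact_mod_cast hL) (by linarith)
  -- the sum over `Λ_0` is at most `|Λ_0| = 1`
  have hsplit : boxSusceptibility J β L =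
      ∑ x ∈ box 3 L \ box 3 0, pairCorrelation J β 0 x + ∑ x ∈ box 3 0, pairCorrelation J β 0 x := by
    rw [boxSusceptibility, Finset.sum_sdiff (box_mono 3 (Nat.zero_le L))]
  have hzero : ∑ x ∈ box 3 0, pairCorrelation J β 0 x ≤ 1 := by
    calc ∑ x ∈ box 3 0, pairCorrelation J β 0 x ≤ ∑ _x ∈ box 3 0, (1 : ℝ) :=
          Finset.sum_le_sum fun x _ => (le_abs_self _).trans (abs_pairCorrelation_le_one J β hβ hJ 0 x)
      _ = 1 := by rw [Finset.sum_const, card_box, nsmul_eq_mul, mul_one]; norm_num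
  have hterm : ∀ x ∈ box 3 L \ box 3 0, pairCorrelation J β 0 x ≤ CE * ((Site.supNorm x : ℝ)) ^ (-(1 + η)) := by
    intro x hx
    rw [Finset.mem_sdiff, mem_box_iff_supNorm_le, mem_box_iff_supNorm_le] at hx
    have hpos : 0 < Site.supNorm x := by omega
    have hx0 : x ≠ 0 := fun h => by rw [h, Site.supNorm_eq_zero_iff.2 rfl] at hpos; exact lt_irrefl 0 hpos
    have hn0 : (0 : ℝ) < Site.supNorm x := by exact_mod_cast hpos
    have h := hE x hx0
    rw [Site.norm_eq_supNorm] at h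
    rwa [Real.rpow_neg hn0.le, ← div_eq_mul_inv]
  calc boxSusceptibility J β L
      = ∑ x ∈ box 3 L \ box 3 0, pairCorrelation J β 0 x + ∑ x ∈ box 3 0, pairCorrelation J β 0 x := hsplit
    _ ≤ ∑ x ∈ box 3 L \ box 3 0, CE * ((Site.supNorm x : ℝ)) ^ (-(1 + η)) + 1 := by
        linarith [Finset.sum_le_sum hterm, hzero]
    _ = CE * ∑ x ∈ box 3 L \ box 3 0, ((Site.supNorm x : ℝ)) ^ (-(1 + η)) + 1 := by rw [Finset.mul_sum]
    _ ≤ CE * (26 * (1 + 1 / (2 - η)) * (L : ℝ) ^ (2 - η)) + 1 := by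
        linarith [mul_le_mul_of_nonneg_left (sum_box_rpow_supNorm_le hη2 hL) hCE]
    _ ≤ CE * (26 * (1 + 1 / (2 - η)) * (L : ℝ) ^ (2 - η)) + (L : ℝ) ^ (2 - η) := by linarith
    _ = (1 + 26 * CE * (1 + 1 / (2 - η))) * (L : ℝ) ^ (2 - η) := by ring

end Main

end LongRangeIsing

open LongRangeIsing

/-- **Panis's bound on `S(β,L,f)` for `d = 3`, from the two-point-level facts**: for
`J_{x,y} = C₀|x-y|₁^{-3-α}` with `3 - 2(α∧2) > 0` (i.e. `α < 3/2`), the tree diagram bound, the MMS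
monotonicity, the sliding-scale infrared bound, the infrared bound `⟨σ₀σ_x⟩ ≤ C/|x|^{3-α}` and
`χ_L ≤ C₂L^{-3}Σ_L` give constants `C, γ > 0` (`γ = 11`) with
`S(β,L,R) ≤ C (β⁻⁴ ∨ β⁻²) R^γ / L^{3-2α}` for all `0 < β ≤ β_c`, `L, R ≥ 1` — the `d = 3` instance of
the named fact `panis_ursellFourBoxSum_le`, along the route of p. 22 of the source (near region
`Λ_{4RL}`: `∑_{u} F(u)⁴ ≤ |Λ_{4RL}|(25C R²χ_L/β)⁴`; far region: MMS + sliding scale for two factors,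
the infrared bound for the other two, and the tail `∑_{|u|>4RL}|u|^{-(4+2η)}`; then `χ_L ≤ C₂L^{-3}Σ_L`,
`χ_L ≤ C₄L^{2-η}`, `η = 2 - α`). [cite: Panis2023Triviality, proof of Theorem 5.5, bounds on (1) and (2) (p. 22), with Remark 5.4] -/
theorem panis_ursellFourBoxSum_le_dim3 (hT : panis_treeDiagramBound) (hM : panis_mms_two_point_monotone)
    (hSS : panis_slidingScale_infraredBound) (hI : panis_infraredBound_algebraic)
    (hX : panis_boxSusceptibility_le_blockVariance) {C₀ α : ℝ} (hC₀ : 0 < C₀) (hα : 0 < α)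
    (hexp : 0 < ((3 : ℕ) : ℝ) - 2 * min α 2) :
    ∃ C γ : ℝ, 0 < C ∧ 0 < γ ∧
      ∀ (β : ℝ), 0 < β → β ≤ LongRangeIsing.criticalBeta (algebraicCoupling 3 C₀ α) →
        ∀ (L R : ℕ), 1 ≤ L → 1 ≤ R →
          ursellFourBoxSum (algebraicCoupling 3 C₀ α) β L R ≤
            C * max (β ^ (-(4 : ℝ))) (β ^ (-(2 : ℝ))) * (R : ℝ) ^ γ / (L : ℝ) ^ (((3 : ℕ) : ℝ) - 2 * min α 2) := by
  set J := algebraicCoupling 3 C₀ α with hJdef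
  have hJ0 : ∀ x y, 0 ≤ J x y := algebraicCoupling_nonneg hC₀.le α
  have hJt : ∀ a x y, J (x + a) (y + a) = J x y := algebraicCoupling_add C₀ α
  have hmin : min α 2 = α := by
    apply min_eq_left
    by_contra h
    push Not at h
    rw [min_eq_right h.le] at hexp
    norm_num at hexp
  have hα32 : α < 3 / 2 := by rw [hmin] at hexp; push_cast at hexp; linarith
  set η : ℝ := 2 - α with hη
  have hη0 : 0 ≤ η := by rw [hη]; linarith
  have hη2 : η < 2 := by rw [hη]; linarith
  have hηpos : 0 < 1 + 2 * η := by linarith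
  have h2η : 0 < 2 - η := by linarith
  obtain ⟨Css, hCss, hss⟩ := hSS 3 (by norm_num) C₀ α hC₀ hα
  obtain ⟨CE, hCE, hE⟩ := hI 3 le_rfl C₀ α hC₀ hα (by linarith)
  obtain ⟨C₂, hC₂, hX'⟩ := hX 3 (by norm_num) C₀ α hC₀ hα
  set C₄ : ℝ := 1 + 26 * CE * (1 + 1 / (2 - η)) with hC₄
  set K₁ : ℝ := 2 * 729 * (25 * Css) ^ 4 * C₄ ^ 2 * C₂ ^ 2 with hK₁
  set K₂ : ℝ := 2 * 26 * 9 * 3 ^ 12 * Css ^ 2 * CE ^ 2 * C₂ ^ 2 / (1 + 2 * η) with hK₂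
  have hK₁0 : 0 ≤ K₁ := by positivity
  have hK₂0 : 0 ≤ K₂ := by positivity
  refine ⟨K₁ + K₂ + 1, 11, by positivity, by norm_num, ?_⟩
  intro β hβ hβc L R hL hR
  have hL0 : (0 : ℝ) < L := by exact_mod_cast hL
  have hR0 : (0 : ℝ) < R := by exact_mod_cast hR
  -- the facts at this `β`
  have hmms : ∀ x y : Site 3, (3 : ℝ) * ‖x‖ ≤ ‖y‖ → pairCorrelation J β 0 y ≤ pairCorrelation J β 0 x :=
    fun x y h => hM 3 (by norm_num) C₀ α hC₀ hα β hβ x y (by exact_mod_cast h)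
  have hssβ : ∀ ℓ m : ℕ, 1 ≤ ℓ → ℓ ≤ m →
      boxSusceptibility J β m / (m : ℝ) ^ 2 ≤ Css / β * (boxSusceptibility J β ℓ / (ℓ : ℝ) ^ 2) :=
    fun ℓ m h1 h2 => hss β hβ hβc ℓ m h1 h2
  have hEβ : ∀ x : Site 3, x ≠ 0 → pairCorrelation J β 0 x ≤ CE / ‖x‖ ^ (1 + η) := by
    intro x hx
    have h := hE β hβ hβc x hx
    rwa [hmin, show ((3 : ℕ) : ℝ) - α = 1 + η by rw [hη]; push_cast; ring] at h
  have hXβ : boxSusceptibility J β L ≤ C₂ * ((L : ℝ) ^ 3)⁻¹ * blockVariance J β L := hX' β hβ hβc L hL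
  -- the quantities of p. 22
  set χ : ℝ := boxSusceptibility J β L with hχ
  set V : ℝ := blockVariance J β L with hV
  have hχ0 : 0 ≤ χ := boxSusceptibility_nonneg J β hβ.le hJ0 L
  have hV1 : 1 ≤ V := one_le_blockVariance J β hβ.le hJ0 L
  have hV0 : 0 < V := by linarith
  have hχ4 : χ ≤ C₄ * (L : ℝ) ^ (2 - η) := boxSusceptibility_le_of_irb J β hβ.le hJ0 hη2 hCE.le hEβ hL
  set A : ℝ := (25 * Css * (R : ℝ) ^ 2 * χ / β) ^ 4 with hA
  set Bf : ℝ := 9 * Css ^ 2 * CE ^ 2 * ((2 * (R * L) + 1 : ℕ) : ℝ) ^ 12 * χ ^ 2 / (β ^ 2 * (L : ℝ) ^ 4) with hBf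
  set q : ℝ := 4 + 2 * η with hq
  set M : ℕ := 4 * (R * L) with hMdef
  have hA0 : 0 ≤ A := by positivity
  have hB0 : 0 ≤ Bf := by positivity
  have hq3 : 3 < q := by rw [hq]; linarith
  have hRL : 1 ≤ R * L := Nat.one_le_iff_ne_zero.2 (Nat.mul_ne_zero (by omega) (by omega))
  have hM1 : 1 ≤ M := by rw [hMdef]; omega
  -- the majorant of `F⁴`
  have hFg : ∀ u : Site 3, boxRowSum J β (R * L) u ^ 4 ≤ rowMajorant A Bf q M u := by
    intro u
    by_cases hu : u ∈ box 3 M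
    · rw [rowMajorant, if_pos hu, hA]
      exact pow_le_pow_left₀ (boxRowSum_nonneg J β hβ.le hJ0 _ u) (boxRowSum_le_near J β hβ hJ0 hJt hssβ hR hL hu) 4
    · rw [rowMajorant, if_neg hu, hBf, hq]
      have hu' : 4 * (R * L) + 1 ≤ Site.supNorm u := by
        rw [mem_box_iff_supNorm_le] at hu
        omega
      exact boxRowSum_pow_four_le_far J β hβ hJ0 hJt hmms hssβ hη0 hη2 hEβ hR hL hu'
  obtain ⟨hsum, htsum⟩ := summable_rowMajorant hA0 hB0 hq3 hM1
  have hU := sum_abs_ursellFour_le J β hβ.le hJ0 (hT 3 (by norm_num) C₀ α hC₀ hα β hβ hβc)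
    (rowMajorant_nonneg hA0 hB0 q M) hsum hFg
  -- the two terms
  have hnear : 2 * (#(box 3 (4 * (R * L))) : ℝ) * (25 * Css * (R : ℝ) ^ 2 * χ / β) ^ 4 / V ^ 2 ≤
      K₁ * β ^ (-(4 : ℝ)) * (R : ℝ) ^ (11 : ℝ) * (L : ℝ) ^ (1 - 2 * η) :=
    near_term_le hχ0 hV1 hβ hR hL hχ4 hXβ
  have hfar : 2 * (9 * Css ^ 2 * CE ^ 2 * ((2 * (R * L) + 1 : ℕ) : ℝ) ^ 12 * χ ^ 2 / (β ^ 2 * (L : ℝ) ^ 4)) *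
        (26 * (((4 * (R * L) : ℕ) : ℝ)) ^ (3 - (4 + 2 * η)) / (4 + 2 * η - 3)) / V ^ 2 ≤
      K₂ * β ^ (-(2 : ℝ)) * (R : ℝ) ^ (11 : ℝ) * (L : ℝ) ^ (1 - 2 * η) :=
    far_term_le hχ0 hV1 hβ hη0 hR hL hXβ
  -- assemble
  have hS : ursellFourBoxSum J β L R ≤ (K₁ * β ^ (-(4 : ℝ)) + K₂ * β ^ (-(2 : ℝ))) * ((R : ℝ) ^ (11 : ℝ) * (L : ℝ) ^ (1 - 2 * η)) := by
    have h1 : ursellFourBoxSum J β L R ≤ 2 * ((#(box 3 M) : ℝ) * A + Bf * (26 * (M : ℝ) ^ (3 - q) / (q - 3))) / V ^ 2 := by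
      rw [ursellFourBoxSum]
      exact div_le_div_of_nonneg_right (hU.trans (by linarith only [htsum])) (sq_nonneg _)
    have h2 : 2 * ((#(box 3 M) : ℝ) * A + Bf * (26 * (M : ℝ) ^ (3 - q) / (q - 3))) / V ^ 2 =
        2 * (#(box 3 (4 * (R * L))) : ℝ) * (25 * Css * (R : ℝ) ^ 2 * χ / β) ^ 4 / V ^ 2 +
        2 * (9 * Css ^ 2 * CE ^ 2 * ((2 * (R * L) + 1 : ℕ) : ℝ) ^ 12 * χ ^ 2 / (β ^ 2 * (L : ℝ) ^ 4)) *
          (26 * (((4 * (R * L) : ℕ) : ℝ)) ^ (3 - (4 + 2 * η)) / (4 + 2 * η - 3)) / V ^ 2 := by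
      rw [hA, hBf, hq, hMdef]
      ring
    rw [h2] at h1
    linarith only [h1, hnear, hfar]
  have hX0 : 0 ≤ (R : ℝ) ^ (11 : ℝ) * (L : ℝ) ^ (1 - 2 * η) := mul_nonneg (Real.rpow_nonneg hR0.le _) (Real.rpow_nonneg hL0.le _)
  have hm4 : β ^ (-(4 : ℝ)) ≤ max (β ^ (-(4 : ℝ))) (β ^ (-(2 : ℝ))) := le_max_left _ _
  have hm2 : β ^ (-(2 : ℝ)) ≤ max (β ^ (-(4 : ℝ))) (β ^ (-(2 : ℝ))) := le_max_right _ _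
  have hm0 : 0 ≤ max (β ^ (-(4 : ℝ))) (β ^ (-(2 : ℝ))) := le_max_of_le_left (Real.rpow_nonneg hβ.le _)
  have hcoef : K₁ * β ^ (-(4 : ℝ)) + K₂ * β ^ (-(2 : ℝ)) ≤ (K₁ + K₂ + 1) * max (β ^ (-(4 : ℝ))) (β ^ (-(2 : ℝ))) := by
    have p1 := mul_le_mul_of_nonneg_left hm4 hK₁0
    have p2 := mul_le_mul_of_nonneg_left hm2 hK₂0
    have p3 : (K₁ + K₂ + 1) * max (β ^ (-(4 : ℝ))) (β ^ (-(2 : ℝ))) =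
        K₁ * max (β ^ (-(4 : ℝ))) (β ^ (-(2 : ℝ))) + K₂ * max (β ^ (-(4 : ℝ))) (β ^ (-(2 : ℝ))) +
          max (β ^ (-(4 : ℝ))) (β ^ (-(2 : ℝ))) := by ring
    rw [p3]
    linarith only [p1, p2, hm0]
  have hpow : (R : ℝ) ^ (11 : ℝ) * (L : ℝ) ^ (1 - 2 * η) = (R : ℝ) ^ (11 : ℝ) / (L : ℝ) ^ (((3 : ℕ) : ℝ) - 2 * min α 2) := by
    rw [hmin, show (1 : ℝ) - 2 * η = -(((3 : ℕ) : ℝ) - 2 * α) by rw [hη]; push_cast; ring, Real.rpow_neg hL0.le,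
      div_eq_mul_inv]
  calc ursellFourBoxSum J β L R ≤ (K₁ * β ^ (-(4 : ℝ)) + K₂ * β ^ (-(2 : ℝ))) * ((R : ℝ) ^ (11 : ℝ) * (L : ℝ) ^ (1 - 2 * η)) := hS
    _ ≤ (K₁ + K₂ + 1) * max (β ^ (-(4 : ℝ))) (β ^ (-(2 : ℝ))) * ((R : ℝ) ^ (11 : ℝ) * (L : ℝ) ^ (1 - 2 * η)) :=
        mul_le_mul_of_nonneg_right hcoef hX0
    _ = (K₁ + K₂ + 1) * max (β ^ (-(4 : ℝ))) (β ^ (-(2 : ℝ))) * (R : ℝ) ^ (11 : ℝ) / (L : ℝ) ^ (((3 : ℕ) : ℝ) - 2 * min α 2) := by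
        rw [hpow, mul_div_assoc]

/-! ### The barrier on `ℤ³` from the two-point-level facts -/

/-- The `d = 3` instance of `panis_thm12` (Theorem 1.2 on `ℤ³`: `0 < α`, `3 - 2(α∧2) > 0`), as a
proposition; `panis_thm12 → panis_thm12_dim3` trivially (`panis_thm12_dim3_of_thm12`), and it is all the
barrier uses. [cite: Panis2023Triviality, Theorem 1.2 (d = 3)] -/
def panis_thm12_dim3 : Prop :=
  ∀ (C₀ α : ℝ), 0 < C₀ → 0 < α → 0 < ((3 : ℕ) : ℝ) - 2 * min α 2 →
    ∀ (f : EuclideanSpace ℝ (Fin 3) → ℝ), Continuous f → HasCompactSupport f →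
      ∃ C : ℝ, 0 < C ∧ ∀ (β : ℝ), 0 < β → β ≤ LongRangeIsing.criticalBeta (algebraicCoupling 3 C₀ α) →
        ∀ (L : ℕ), 1 ≤ L → ∀ (z : ℝ),
          mgfDeviation (algebraicCoupling 3 C₀ α) β L f z ≤
            Real.exp (z ^ 2 / 2 * state (algebraicCoupling 3 C₀ α) β 0
                (fun σ => smeared (algebraicCoupling 3 C₀ α) β L (fun x => |f x|) σ ^ 2)) *
              (C * max (β ^ (-(4 : ℝ))) (β ^ (-(2 : ℝ))) * z ^ 4 / (L : ℝ) ^ (((3 : ℕ) : ℝ) - 2 * min α 2))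

/-- `panis_thm12 → panis_thm12_dim3`. [cite: Panis2023Triviality, Theorem 1.2] -/
theorem panis_thm12_dim3_of_thm12 (h : panis_thm12) : panis_thm12_dim3 :=
  fun C₀ α hC₀ hα hexp f hf hfs => h 3 (by norm_num) C₀ α hC₀ hα hexp f hf hfs

/-- **Theorem 1.2 on `ℤ³` from the moment-generating-function fact and the `d = 3` bound on
`S(β,L,f)`** (the argument of `panis_thm12_of_inputs` at `d = 3`).
[cite: Panis2023Triviality, proof of Theorem 5.5 (pp. 21–22)] -/
theorem panis_thm12_dim3_of_twoPoint (hMgf : panis_mgfDeviation_le_ursellFourBoxSum)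
    (hT : panis_treeDiagramBound) (hM : panis_mms_two_point_monotone)
    (hSS : panis_slidingScale_infraredBound) (hI : panis_infraredBound_algebraic)
    (hX : panis_boxSusceptibility_le_blockVariance) : panis_thm12_dim3 := by
  intro C₀ α hC₀ hα hexp f hf hfs
  set J := algebraicCoupling 3 C₀ α with hJ
  obtain ⟨C₁, hC₁, hMb⟩ := hMgf 3 (by norm_num) C₀ α hC₀ hα hexp
  obtain ⟨C, γ, hC, _, hSb⟩ := panis_ursellFourBoxSum_le_dim3 hT hM hSS hI hX hC₀ hα hexp
  obtain ⟨R, hR, hfR⟩ := exists_nat_forall_abs_apply_le f hfs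
  set F : ℝ := (⨆ x, |f x|) ^ 4 with hF
  have hF0 : 0 ≤ F := pow_nonneg (Real.iSup_nonneg fun x => abs_nonneg (f x)) 4
  refine ⟨C₁ * (F + 1) * C * (R : ℝ) ^ γ, by positivity, fun β hβ hβc L hL z => ?_⟩
  set V : ℝ := state J β 0 (fun σ => smeared J β L (fun x => |f x|) σ ^ 2) with hV
  set m : ℝ := max (β ^ (-(4 : ℝ))) (β ^ (-(2 : ℝ))) with hm
  set E : ℝ := (L : ℝ) ^ (((3 : ℕ) : ℝ) - 2 * min α 2) with hE
  have hm0 : 0 ≤ m := le_max_of_le_left (Real.rpow_nonneg hβ.le _)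
  have hE0 : 0 < E := Real.rpow_pos_of_pos (by exact_mod_cast hL) _
  have h1 := hMb β hβ hβc L R hL hR f hf hfR z
  have h2 := hSb β hβ hβc L R hL hR
  have hS0 : 0 ≤ ursellFourBoxSum J β L R := ursellFourBoxSum_nonneg J β L R
  calc mgfDeviation J β L f z
      ≤ C₁ * z ^ 4 * Real.exp (z ^ 2 / 2 * V) * F * ursellFourBoxSum J β L R := h1
    _ ≤ C₁ * z ^ 4 * Real.exp (z ^ 2 / 2 * V) * (F + 1) * (C * m * (R : ℝ) ^ γ / E) := by
        apply mul_le_mul _ h2 hS0 (by positivity)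
        exact mul_le_mul_of_nonneg_left (by linarith) (by positivity)
    _ = Real.exp (z ^ 2 / 2 * V) * (C₁ * (F + 1) * C * (R : ℝ) ^ γ * m * z ^ 4 / E) := by ring

/-- **Theorem 1.2 on `ℤ³` at `β_c > 0` excludes non-Gaussian critical smearings** (the `β_c > 0`
branch of `LongRangeTrivialityOnZ3.of_thm12`, needing only `panis_thm12_dim3`).
[cite: Panis2023Triviality, Theorem 1.2] -/
theorem not_hasNonGaussianSmearingZ3_of_thm12_dim3 (h12 : panis_thm12_dim3) {C₀ α : ℝ} (hC₀ : 0 < C₀)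
    (hα : 0 < α) (hα' : α < 3 / 2)
    (hβc : 0 < LongRangeIsing.criticalBeta (algebraicCoupling 3 C₀ α)) :
    ¬ HasNonGaussianSmearingZ3 (algebraicCoupling 3 C₀ α) := by
  rintro ⟨f, hf, hfs, z, hnot⟩
  apply hnot
  set J := algebraicCoupling 3 C₀ α with hJ
  have hexp := longRange_exponent_pos hα'
  obtain ⟨C, hC, hbound⟩ := h12 C₀ α hC₀ hα hexp f hf hfs
  have hfa : Continuous fun x => |f x| := hf.abs
  have hfas : HasCompactSupport fun x => |f x| := hfs.norm
  obtain ⟨Cf, hCf⟩ := panis_variance_bound_holds 3 (by norm_num) C₀ α hC₀ hα (fun x => |f x|) hfa hfas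
  set K : ℝ := Real.exp (z ^ 2 / 2 * Cf) *
    (C * max (LongRangeIsing.criticalBeta J ^ (-(4 : ℝ))) (LongRangeIsing.criticalBeta J ^ (-(2 : ℝ))) * z ^ 4)
    with hK
  have hmaj : ∀ L : ℕ, 1 ≤ L →
      mgfDeviation J (LongRangeIsing.criticalBeta J) L f z ≤ K * ((L : ℝ) ^ (((3 : ℕ) : ℝ) - 2 * min α 2))⁻¹ := by
    intro L hL
    have h1 := hbound (LongRangeIsing.criticalBeta J) hβc le_rfl L hL z
    have hCz : 0 ≤ C * max (LongRangeIsing.criticalBeta J ^ (-(4 : ℝ)))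
        (LongRangeIsing.criticalBeta J ^ (-(2 : ℝ))) * z ^ 4 := by
      have : 0 ≤ max (LongRangeIsing.criticalBeta J ^ (-(4 : ℝ))) (LongRangeIsing.criticalBeta J ^ (-(2 : ℝ))) :=
        le_max_of_le_left (Real.rpow_nonneg hβc.le _)
      positivity
    have hLpos : 0 < (L : ℝ) ^ (((3 : ℕ) : ℝ) - 2 * min α 2) := Real.rpow_pos_of_pos (by exact_mod_cast hL) _
    have h2 : Real.exp (z ^ 2 / 2 * state J (LongRangeIsing.criticalBeta J) 0
          (fun σ => smeared J (LongRangeIsing.criticalBeta J) L (fun x => |f x|) σ ^ 2)) ≤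
        Real.exp (z ^ 2 / 2 * Cf) := by
      apply Real.exp_le_exp.2
      exact mul_le_mul_of_nonneg_left (hCf L hL) (by positivity)
    calc mgfDeviation J (LongRangeIsing.criticalBeta J) L f z
        ≤ Real.exp (z ^ 2 / 2 * state J (LongRangeIsing.criticalBeta J) 0
            (fun σ => smeared J (LongRangeIsing.criticalBeta J) L (fun x => |f x|) σ ^ 2)) *
            (C * max (LongRangeIsing.criticalBeta J ^ (-(4 : ℝ))) (LongRangeIsing.criticalBeta J ^ (-(2 : ℝ))) * z ^ 4 /
              (L : ℝ) ^ (((3 : ℕ) : ℝ) - 2 * min α 2)) := h1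
      _ ≤ Real.exp (z ^ 2 / 2 * Cf) *
            (C * max (LongRangeIsing.criticalBeta J ^ (-(4 : ℝ))) (LongRangeIsing.criticalBeta J ^ (-(2 : ℝ))) * z ^ 4 /
              (L : ℝ) ^ (((3 : ℕ) : ℝ) - 2 * min α 2)) :=
          mul_le_mul_of_nonneg_right h2 (div_nonneg hCz hLpos.le)
      _ = K * ((L : ℝ) ^ (((3 : ℕ) : ℝ) - 2 * min α 2))⁻¹ := by rw [hK]; ring
  have hlim : Tendsto (fun L : ℕ => K * ((L : ℝ) ^ (((3 : ℕ) : ℝ) - 2 * min α 2))⁻¹) atTop (𝓝 0) := by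
    have h1 : Tendsto (fun L : ℕ => ((L : ℝ) ^ (((3 : ℕ) : ℝ) - 2 * min α 2))⁻¹) atTop (𝓝 0) :=
      ((tendsto_rpow_atTop hexp).comp tendsto_natCast_atTop_atTop).inv_tendsto_atTop
    simpa using h1.const_mul K
  refine squeeze_zero' (Eventually.of_forall fun L => abs_nonneg _) ?_ hlim
  exact eventually_atTop.2 ⟨1, hmaj⟩

/-- The barrier granted `panis_thm12_dim3` (as `of_thm12`, with the `β_c = 0` case settled by the
infinite-temperature central limit theorem). [cite: Panis2023Triviality, Theorem 1.2] -/
theorem LongRangeTrivialityOnZ3.of_thm12_dim3 (h12 : panis_thm12_dim3) : LongRangeTrivialityOnZ3 := by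
  intro C₀ α hC₀ hα hα'
  rcases (criticalBeta_nonneg (algebraicCoupling 3 C₀ α)).eq_or_lt with h0 | hpos
  · exact not_hasNonGaussianSmearingZ3_of_criticalBeta_eq_zero (algebraicCoupling_nonneg hC₀.le α) h0.symm
  · exact not_hasNonGaussianSmearingZ3_of_thm12_dim3 h12 hC₀ hα hα' hpos

-- names the `@[deprecated]` (refuted) fact `panis_evenMoment_deviation_le` of `…Moments` on purpose: a vacuous record
-- of the printed chain (verdict clean-up 2026-08-16, `…Moments` §Verdict clean-up); REMOVE-WHEN this theorem is retired
set_option linter.deprecated false in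
/-- **The barrier `LongRangeTrivialityOnZ3` from printed, classical named facts only**: Aizenman's
deviation from Wick's law (smeared; Panis p. 21), Newman's Gaussian domination (finite volume), the
tree diagram bound, the Messager–Miracle-Solé monotonicity, the sliding-scale infrared bound, the
infrared bound for the algebraic couplings, and `χ_L ≤ C₂L^{-d}Σ_L`. Everything else — the
infinite-temperature case, the window law and the summation, the `ℤ³` lattice estimates of p. 22 — is
proved in the tree.
**Vacuous since 2026-08-16:** the hypothesis `panis_evenMoment_deviation_le` is refuted
(`not_panis_evenMoment_deviation_le_of_criticalBeta_pos`, `…Wick`, with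
`panis_criticalBeta_pos_holds`; `…Moments`, §Verdict clean-up) — the conclusion is meanwhile a
theorem outright (`panis_mgfDeviation_le_ursellFourBoxSum_holds`, `panis_thm12_holds`,
`LongRangeTrivialityOnZ3_holds`).
[cite: Panis2023Triviality, Theorem 1.2 and proof of Theorem 5.5] -/
theorem LongRangeTrivialityOnZ3.of_twoPoint (h51 : panis_evenMoment_deviation_le)
    (hN : newman_gaussian_evenMoment_le) (hT : panis_treeDiagramBound) (hM : panis_mms_two_point_monotone)
    (hSS : panis_slidingScale_infraredBound) (hI : panis_infraredBound_algebraic)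
    (hX : panis_boxSusceptibility_le_blockVariance) : LongRangeTrivialityOnZ3 :=
  LongRangeTrivialityOnZ3.of_thm12_dim3
    (panis_thm12_dim3_of_twoPoint (panis_mgfDeviation_le_ursellFourBoxSum_of_moments h51 hN) hT hM hSS hI hX)

end Literature.Barriers.CriticalPhenomena

end
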